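import Mathlib
import Literature.AlgebraicGeometry.CossartPiltant200819.Thm15iBaseSidePhase2019
import Literature.AlgebraicGeometry.Resolution.LocalBlowup
import Literature.AlgebraicGeometry.Resolution.QuadraticTransforms
import Summits.ResolutionOfSingularities.ResolutionOfSingularities.Theorems.RadicialJungCleanModelsLens5PRankTwoCurrency
import Summits.ResolutionOfSingularities.ResolutionOfSingularities.Theorems.RadicialJungCleanModelsConeExit
import Summits.ResolutionOfSingularities.ResolutionOfSingularities.Theorems.RadicialJungCleanModelsConeExitMorse
import HarnessLib

/-!
# Route `RadicialJung`, crux `CleanModels` (stmt-15917), line `Sketch`: the dim-3 residual at `p = 3` after the printed phase, in ONE declaration — clean, or a DEGENERATE quadratic return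

Line lead `res-B-lead-1` g10, `--supports stmt-ResolutionOfSingularities-15917`.  Assembly of ✓ `ConeExit.cleanLUConcl_or_firstReturn_of_baseSidePhaseAt` (every `p`)
and ✓ `ConeExit.cleanLUConcl_of_nondegenerate` (the Morse exit) at `p = 3`, where the END of Cossart–Piltant's base-side phase (INPUTS wi-91399, the `p = 3` instance of
`CossartPiltant2019_thm_1_5_i_baseSidePhase`) leaves `e = max_c ord(h - c³) = 2` as the only non-clean case: for EVERY valuation ring `O` with a 3-dimensional regular
finitely generated centre and every non-cube `g₀`, EITHER `CleanLUConcl 3 k K O A g₀`, OR there is an END stage `R' = locAtCentre A' O` with a representative `h` of the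
`K³`-line, `h ∈ 𝔪²`, `h - c'³ ∉ 𝔪³` for all `c'`, whose quadratic tangent cone is DEGENERATE in every regular system of parameters (the polar forms of every quadratic
form `Q` with `h ≡ Q(t) (mod 𝔪³)` fail to span `𝔪/𝔪²`: corank `≥ 1`), AND the centre of `O` on the quadratic transform is a singular point of that cone (`h = x²G`,
`G ∈ 𝔪₁² + (x)`, so `h ∈ 𝔪₁³`: the multiplicity is back to `3` and the printed phase re-applies).  This is the registered research residual of Sketch rev 34/35 at `p = 3`,
read after the printed phase, in one citable statement.

Honest framing: OURS · counted 0 · a dichotomy, not a termination statement; nothing here proves resolution in characteristic `3`.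
-/

noncomputable section

set_option linter.dupNamespace false

open IsLocalRing
open Literature.AlgebraicGeometry.Resolution
open Literature.AlgebraicGeometry.CossartPiltant200819
open Summit.ResolutionOfSingularities.ResolutionOfSingularities.Theorems.RadicialJung.CleanModels.Lens5.PRankTwoCurrency

namespace Summit.ResolutionOfSingularities.ResolutionOfSingularities.Theorems.RadicialJung.CleanModels.ConeExit

/-- **The dim-3 residual at `p = 3` after the printed phase: CLEAN, or a DEGENERATE QUADRATIC RETURN.**  See the module docstring.  From the `p = 3` instance of
Cossart–Piltant 2019 Thm. 1.5 (i) base-side (wi-91399), for every valuation ring, every ground field of characteristic `3`.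
[cite: CossartPiltant2019, Thm. 1.5 (i) pp. 271–272; Cor. 5.6 p. 405; Prop. 2.22 pp. 294–295] -/
theorem cleanLUConcl_or_degenerateReturn_three
    (hBS3 : (∀ (S : Type) [CommRing S] [IsRegularLocalRing S],
          IsExcellentRing S → ringKrullDim S = 3 → CharP S 3 →
          ∀ (K : Type) [Field K] [Algebra S K] [IsFractionRing S K] (f : S),
          (∀ c : K, c ^ 3 ≠ algebraMap S K f) →
          ∀ (O : ValuationSubring K), (algebraMap S K).range ≤ O.toSubring →
          (∀ s ∈ IsLocalRing.maximalIdeal S, O.valuation (algebraMap S K s) < 1) →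
          ∃ (n : ℕ) (B : ℕ → Subring K) (g : ℕ → K),
          B 0 = locAtCentre (algebraMap S K).range O ∧ g 0 = algebraMap S K f ∧
          (∀ i ≤ n, B i ≤ O.toSubring ∧ IsRegularLocalRing (B i) ∧ g i ∈ B i) ∧
          (∀ i < n, ∃ P : Ideal (B i), IsRegularLocalRing ((B i) ⧸ P) ∧
            IsLocalBlowupAlong O (B i) P (B (i + 1)) ∧
            ∃ c d : K, c ≠ 0 ∧ g (i + 1) = c ^ 3 * g i + d ^ 3) ∧
          ∀ (hg : g n ∈ B n) (_hBn : IsRegularLocalRing (B n)) (c : B n),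
            (⟨g n, hg⟩ : B n) - c ^ 3 ∉ IsLocalRing.maximalIdeal (B n) ^ 3))
    (k : Type) [Field k] [CharP k 3] (K : Type) [Field K] [Algebra k K]
    (O : ValuationSubring K) (A : Subalgebra k K) (hAO : A.toSubring ≤ O.toSubring) (hAfg : A.FG)
    (hfrac : IsFractionRing A K) (hreg : IsRegularLocalRing (locAtCentre A.toSubring O))
    (hdim3 : ringKrullDim (locAtCentre A.toSubring O) = 3) (g₀ : K) (hg₀ : ∀ c : K, c ^ 3 ≠ g₀) :
    CleanLUConcl 3 k K O A g₀ ∨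
    ∃ (A' : Subalgebra k K) (_ : A'.toSubring ≤ O.toSubring) (_ : A ≤ A') (_ : A'.FG)
      (_ : IsRegularLocalRing (locAtCentre A'.toSubring O))
      (c : Fin 3 → K) (h : locAtCentre A'.toSubring O),
      (∃ j : Fin 3, (j : ℕ) ≠ 0 ∧ c j ≠ 0) ∧ (∑ j : Fin 3, c j ^ 3 * g₀ ^ (j : ℕ)) = (h : K) ∧
      h ∈ maximalIdeal (locAtCentre A'.toSubring O) ^ 2 ∧
      (∀ c' : locAtCentre A'.toSubring O, h - c' ^ 3 ∉ maximalIdeal (locAtCentre A'.toSubring O) ^ 3) ∧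
      -- DEGENERACY of the quadratic tangent cone, in every regular system of parameters and every writing `h ≡ Q(t) (mod 𝔪³)`
      (∀ (d : ℕ), 0 < d → (maximalIdeal (locAtCentre A'.toSubring O)).spanFinrank = d →
        ∀ (t : Fin d → locAtCentre A'.toSubring O), Ideal.span (Set.range t) = maximalIdeal (locAtCentre A'.toSubring O) →
        ∀ (a : Fin d → Fin d → locAtCentre A'.toSubring O),
          h - ∑ i, ∑ j, a i j * t i * t j ∈ maximalIdeal (locAtCentre A'.toSubring O) ^ 3 →
          ∃ i, t i ∉ Ideal.span (Set.range fun k => ∑ j, (a k j + a j k) * t j) ⊔ maximalIdeal (locAtCentre A'.toSubring O) ^ 2) ∧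
      -- the RETURN: on the quadratic transform the centre of `O` is a singular point of the cone
      ∃ (A'' : Subalgebra k K) (_ : A''.toSubring ≤ O.toSubring) (_ : A' ≤ A'') (_ : A''.FG)
        (_ : IsQuadraticTransformAlong O (locAtCentre A'.toSubring O) (locAtCentre A''.toSubring O))
        (_ : IsRegularLocalRing (locAtCentre A''.toSubring O))
        (x : locAtCentre A'.toSubring O) (hxR₁ : (x : K) ∈ locAtCentre A''.toSubring O) (G : locAtCentre A''.toSubring O),
        x ∈ maximalIdeal (locAtCentre A'.toSubring O) ∧ (x : K) ≠ 0 ∧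
        (∀ y ∈ maximalIdeal (locAtCentre A'.toSubring O), O.valuation (y : K) ≤ O.valuation (x : K)) ∧
        (⟨(x : K), hxR₁⟩ : locAtCentre A''.toSubring O) ∈ maximalIdeal (locAtCentre A''.toSubring O) ∧
        (⟨(x : K), hxR₁⟩ : locAtCentre A''.toSubring O) ∉ maximalIdeal (locAtCentre A''.toSubring O) ^ 2 ∧
        (h : K) = (x : K) ^ 2 * (G : K) ∧
        G ∈ maximalIdeal (locAtCentre A''.toSubring O) ^ 2 ⊔ Ideal.span {(⟨(x : K), hxR₁⟩ : locAtCentre A''.toSubring O)} := by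
  classical
  rcases cleanLUConcl_or_firstReturn_of_baseSidePhaseAt 3 Nat.prime_three hBS3 k K O A hAO hAfg hfrac hreg hdim3 g₀ hg₀ with hclean | hret
  · exact Or.inl hclean
  · obtain ⟨A', hA'O, hAA', hA'fg, hregA', c, h, e, hc0, hc, he2, he3, hhe, hmax, A'', hA''O, hA'A'', hA''fg, hq, hreg₁, x, hxR₁, G,
      hx, hx0, hmin, hxm₁, hx2₁, hG, hGt⟩ := hret
    have he : e = 2 := by omega
    subst he
    by_cases hM : ∃ (d : ℕ) (_ : 0 < d) (_ : (maximalIdeal (locAtCentre A'.toSubring O)).spanFinrank = d)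
        (t : Fin d → locAtCentre A'.toSubring O) (_ : Ideal.span (Set.range t) = maximalIdeal (locAtCentre A'.toSubring O))
        (a : Fin d → Fin d → locAtCentre A'.toSubring O),
        h - ∑ i, ∑ j, a i j * t i * t j ∈ maximalIdeal (locAtCentre A'.toSubring O) ^ 3 ∧
        ∀ i, t i ∈ Ideal.span (Set.range fun k => ∑ j, (a k j + a j k) * t j) ⊔ maximalIdeal (locAtCentre A'.toSubring O) ^ 2
    · obtain ⟨d, hd0, hd, t, ht, a, hQ, hJ⟩ := hM
      exact Or.inl (cleanLUConcl_of_nondegenerate Nat.prime_three (by norm_num) O A A' hA'O hAA' hA'fg hregA' g₀ c hc0 h hc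
        hd0 hd t ht a hQ hJ)
    · push Not at hM
      refine Or.inr ⟨A', hA'O, hAA', hA'fg, hregA', c, h, hc0, hc, hhe, fun c' => by simpa using hmax c', ?_, A'', hA''O, hA'A'',
        hA''fg, hq, hreg₁, x, hxR₁, G, hx, hx0, hmin, hxm₁, hx2₁, hG, hGt⟩
      intro d hd0 hd t ht a hQ
      exact hM d hd0 hd t ht a hQ

end Summit.ResolutionOfSingularities.ResolutionOfSingularities.Theorems.RadicialJung.CleanModels.ConeExit

end
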